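import Summits.BirchSwinnertonDyer.Rank1Residual.Additive.GordDescent
import HarnessLib

/-!
# X3♯(G-ord) / X4♯(G-ord), defect 2: the relocated over-`K` input is EXACTLY what is needed

HONEST FRAMING (cell `b2b-bsdres`, run/shared/lean/b2b/bsd-rank1-residual/, verbatim in every
file): the goal of the cell is to DELETE the COMBINATION-SHAPED residual classes of the
Birch–Swinnerton-Dyer formula for ALL analytic-rank `≤ 1` elliptic curves over `ℚ` — "full BSD
formula for every rank `≤ 1` curve in class `C`" assembled STRICTLY from published theorems — so
that the rank-`≤ 1` remainder becomes exactly the CONSTRUCTION-SHAPED classes, which are TYPED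
(missing-input `Prop`s), NOT attempted. This is not "finishing BSD". Sub-cell `additive-p2`
(X3/X4 at an additive prime, potentially good ORDINARY half): research route; no claim beyond the
stated classes; theorems only, no named fact.

`GordDescent.lean` converts `BSD(E,p)` for an X3♯/X4♯(G-ord) pair of defect 2 whose good-ordinary
twist pair `(E^{(p*)}, p)` is COVERED into the single typed over-`K` statement
`AdditivePotMult.MissingPPartOverAt W' p` (`W'` a globally minimal model of `E_K`, `K = ℚ(√p*)`).
This file proves the CONVERSE bookkeeping, so that the relocation loses nothing: for ANY quadratic
`K` and any prime `p`, `BSD(E,p) ∧ BSD(E^{(d_K)},p) ⟹ MissingPPartOverAt(E_K, p)`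
(`pPartOver_of_bsdp_of_bsdp_twist`, from additive-p1's identity (★) `shaAnOver_mul_eq` and Milne's
Weil-restriction theorem), hence **`MissingPPartOverAt(E_K,p) ⟺ BSD(E,p)` whenever `BSD(E^{(d_K)},p)`
holds** (`missingPPartOverAt_iff_bsdp_of_bsdp_twist`) — in particular on every row of the map of
`GordDescent.lean` marked "ALONE" (e.g. `missingPPartOverAt_iff_bsdp_of_classX4_of_goodOrd_twist`:
X4, `p > 3`, non-CM, (im)). So on those sub-populations the open problem `BSD(E,p)` and the typed
input "p-part of BSD for `E_K` at the ramified good-ordinary prime `𝔭`" are the SAME statement,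
granted published theorems; the located gap (module docstring of `GordDescent.lean`) is unchanged.

References: J. S. Milne, Invent. Math. 17 (1972) Thm. 1; T. & V. Dokchitser, Ann. of Math. 172
(2010) §2.1; A. Burungale, F. Castella, C. Skinner, IMRN 2025 Cor. 1.3.1; R. L. Miller, LMS J.
Comput. Math. 14 (2011) Def. 1.1.
-/

noncomputable section

open scoped Classical

open WeierstrassCurve Literature.NumberTheory.EllipticCurves
  Literature.NumberTheory.EllipticCurves.Rank1Residual
  Literature.NumberTheory.EllipticCurves.Rank1Residual.Typed
  Summit.BirchSwinnertonDyer.Rank1Residual.AdditivePotMult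

namespace Summit.BirchSwinnertonDyer.Rank1Residual.Additive

variable (W : WeierstrassCurve ℚ) [W.IsElliptic] [W.IsGloballyMinimal] (p : ℕ) [hp : Fact p.Prime]
  (K : Type) [Field K] [NumberField K]
  (Wd : WeierstrassCurve ℚ) [Wd.IsElliptic] [Wd.IsGloballyMinimal]
  (W' : WeierstrassCurve K) [W'.IsElliptic] [W'.IsGloballyMinimal]

/-- **The converse of the descent theorem.** For `W/ℚ` globally minimal of analytic rank `≤ 1`, a
quadratic field `K`, a globally minimal model `Wd` of `W^{(d_K)}` of analytic rank `≤ 1` and a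
globally minimal `K`-model `W'` of `W_K`: `BSD(W,p) ∧ BSD(Wd,p) ⟹ MissingPPartOverAt W' p`. From
(★) `#Ш_an(W')·#Ш(W)·#Ш(Wd) = #Ш_an(W)·#Ш_an(Wd)·#Ш(W')` (`shaAnOver_mul_eq`, Milne's identity
`hMilne` for `hWR` and the finiteness of `Ш(W'/K)`), rationality and
`ord_p #Ш_an(W') = ord_p #Ш(W) + ord_p #Ш(Wd) + ord_p #Ш(W') − ord_p #Ш(W) − ord_p #Ш(Wd)`.
Inputs: Gross–Zagier–Kolyvagin (`hGZK`), modularity (`hmod`), Milne 1972 (`hMilne`). -/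
theorem pPartOver_of_bsdp_of_bsdp_twist
    (hGZK : rank_eq_analyticRank_of_analyticRank_le_one) (hmod : hasEntireLFunction_rat)
    (hMilne : Milne1972.bsdQuotient_baseChange_quadratic)
    (hr : W.analyticRank ≤ 1) (h2 : Module.finrank ℚ K = 2)
    (hWd : ∃ C : VariableChange ℚ, C • W.quadraticTwist (NumberField.discr K : ℚ) = Wd)
    (hrd : Wd.analyticRank ≤ 1)
    (hW' : ∃ C : VariableChange K, C • W.baseChange K = W')
    (hW : BSDp W p) (hd : BSDp Wd p) : MissingPPartOverAt W' p := by
  obtain ⟨-, hfinW⟩ := hGZK W hr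
  obtain ⟨-, hfinD⟩ := hGZK Wd hrd
  haveI : Finite W.sha := hfinW
  haveI : Finite Wd.sha := hfinD
  obtain ⟨hshaK, hWR⟩ := hMilne W K h2 Wd hWd W' hW' hfinW hfinD
  obtain ⟨qW, hqW, hvW⟩ := missingPPartAt_of_bsdp W p hW
  obtain ⟨qd, hqd, hvd⟩ := missingPPartAt_of_bsdp Wd p hd
  have hstar := shaAnOver_mul_eq W K Wd W' hmod h2 hWd hW' hfinW hfinD hshaK hWR
  have hsW : W.shaOrder ≠ 0 := (W.shaOrder_pos hfinW).ne'
  have hsD : Wd.shaOrder ≠ 0 := (Wd.shaOrder_pos hfinD).ne'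
  have hsK : W'.shaOrder ≠ 0 := (W'.shaOrder_pos hshaK).ne'
  -- the two analytic Sha orders over `ℚ` are nonzero rationals
  have hne : ∀ (V : WeierstrassCurve ℚ) [V.IsElliptic] (q : ℚ), shaAn V = (q : ℂ) → q ≠ 0 := by
    intro V _ q hq h0
    rw [h0, Rat.cast_zero, shaAn_def, div_eq_zero_iff] at hq
    rcases hq with h | h
    · rcases mul_eq_zero.mp h with h | h
      · exact V.leadingLCoeff_ne_zero_holds (hmod V) h
      · exact (pow_ne_zero 2 (by exact_mod_cast V.torsionOrder_pos_holds.ne' :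
          (V.torsionOrder : ℂ) ≠ 0)) h
    · rcases mul_eq_zero.mp h with h | h
      · rcases mul_eq_zero.mp h with h | h
        · exact (by exact_mod_cast V.realPeriodRat_pos_holds.ne' : (V.realPeriodRat : ℂ) ≠ 0) h
        · exact (by exact_mod_cast V.tamagawaProduct_pos_holds.ne' :
            (V.tamagawaProduct : ℂ) ≠ 0) h
      · exact (by exact_mod_cast V.regulator_pos'.ne' : (V.regulator : ℂ) ≠ 0) h
  have hqW0 : qW ≠ 0 := hne W qW hqW
  have hqd0 : qd ≠ 0 := hne Wd qd hqd
  -- solve (★) for `#Ш_an(W')`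
  set q' : ℚ := qW * qd * W'.shaOrder / (W.shaOrder * Wd.shaOrder) with hq'_def
  refine ⟨q', ?_, ?_⟩
  · have hden : (W.shaOrder : ℂ) * (Wd.shaOrder : ℂ) ≠ 0 :=
      mul_ne_zero (by exact_mod_cast hsW) (by exact_mod_cast hsD)
    rw [hq'_def]
    push_cast
    rw [eq_div_iff hden, ← hqW, ← hqd]
    linear_combination hstar
  · have hsWq : (W.shaOrder : ℚ) ≠ 0 := by exact_mod_cast hsW
    have hsDq : (Wd.shaOrder : ℚ) ≠ 0 := by exact_mod_cast hsD
    have hsKq : (W'.shaOrder : ℚ) ≠ 0 := by exact_mod_cast hsK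
    rw [hq'_def, padicValRat.div (mul_ne_zero (mul_ne_zero hqW0 hqd0) hsKq) (mul_ne_zero hsWq hsDq),
      padicValRat.mul (mul_ne_zero hqW0 hqd0) hsKq, padicValRat.mul hqW0 hqd0,
      padicValRat.mul hsWq hsDq, hvW, hvd, padicValRat.of_nat, padicValRat.of_nat,
      padicValRat.of_nat]
    ring

/-- **The relocation is exact.** Under the hypotheses of the descent theorem and GIVEN `BSD(Wd,p)`
for the twist (e.g. a Covered twist pair): `MissingPPartOverAt W' p ↔ BSD(W,p)` — the typed
over-`K` input is neither weaker nor stronger than the target. -/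
theorem missingPPartOverAt_iff_bsdp_of_bsdp_twist
    (hGZK : rank_eq_analyticRank_of_analyticRank_le_one) (hmod : hasEntireLFunction_rat)
    (hMilne : Milne1972.bsdQuotient_baseChange_quadratic)
    (hr : W.analyticRank ≤ 1) (h2 : Module.finrank ℚ K = 2)
    (hWd : ∃ C : VariableChange ℚ, C • W.quadraticTwist (NumberField.discr K : ℚ) = Wd)
    (hrd : Wd.analyticRank ≤ 1)
    (hW' : ∃ C : VariableChange K, C • W.baseChange K = W') (hd : BSDp Wd p) :
    MissingPPartOverAt W' p ↔ BSDp W p :=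
  ⟨fun hK => bsdp_of_pPartOver_of_bsdp_twist' W p K Wd W' hGZK hmod hMilne hr h2 hWd hrd hW' hK hd,
    fun hW => pPartOver_of_bsdp_of_bsdp_twist W p K Wd W' hGZK hmod hMilne hr h2 hWd hrd hW' hW hd⟩

/-- **On a Covered twist pair, the over-`K` input IS `BSD(E,p)`** (any prime, any quadratic `K`):
granted the fourteen published facts of the covered rows, Milne, GZK and modularity,
`MissingPPartOverAt W' p ↔ BSD(W,p)` whenever `(Wd, p)` is Covered. -/
theorem missingPPartOverAt_iff_bsdp_of_covered_twist
    (hSk : Skinner2016.thmC_padicValRat_bsd_rank_zero)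
    (hBCS : BurungaleCastellaSkinner2025.cor131_padicValRat_bsd_rank_le_one)
    (hJSW : JetchevSkinnerWan2017.thm121_padicValRat_bsd_rank_one)
    (hCGS : CastellaGrossiSkinner2025.thmD_padicValRat_bsd_rank_le_one)
    (hGV : GreenbergVatsal2000.thm13_charIdeal_eq_of_gvPar) (hGr : greenberg_charValue_rankZero)
    (hmod : hasEntireLFunction_rat) (hmodP : ModularForms.nonempty_modularParametrizationData)
    (hGZK : rank_eq_analyticRank_of_analyticRank_le_one)
    (hCM : bsdTriple_of_hasCM_of_L_one_ne_zero) (hKob : Kobayashi2013.cor14_bsdp_of_cm_rank_one)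
    (hYZ : YanZhu2026.thm415_padicValRat_bsd_rank_le_one)
    (hW20 : Wuthrich2014.lemma20_surjective_threeAdic_of_semistable)
    (hLLT : LiLiuTian2024.thm11_bsdp_of_cm_rank_one)
    (hMilne : Milne1972.bsdQuotient_baseChange_quadratic)
    (hr : W.analyticRank ≤ 1) (h2 : Module.finrank ℚ K = 2)
    (hWd : ∃ C : VariableChange ℚ, C • W.quadraticTwist (NumberField.discr K : ℚ) = Wd)
    (hrd : Wd.analyticRank ≤ 1) (hcov : Covered Wd p)
    (hW' : ∃ C : VariableChange K, C • W.baseChange K = W') :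
    MissingPPartOverAt W' p ↔ BSDp W p :=
  missingPPartOverAt_iff_bsdp_of_bsdp_twist W p K Wd W' hGZK hmod hMilne hr h2 hWd hrd hW'
    (bsdp_of_covered hSk hBCS hJSW hCGS hGV hGr hmod hmodP hGZK hCM hKob hYZ hW20 hLLT hrd hcov)

/-- **X4♯(G-ord), defect 2, `p > 3`, non-CM, (im): `BSD(E,p)` IS the over-`K` statement.** Under the
hypotheses of `bsdp_of_classX4_of_goodOrd_twist` (twist pair = row C2, Burungale–Castella–Skinner
2025 Cor. 1.3.1 `hBCS`): `MissingPPartOverAt W' p ↔ BSD(W,p)`. On this sub-population (census: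
226 of the 380 X4♯(G-ord) defect-2 pairs, N < 2·10⁴; 143 more at `p = 3` via row C16) the open
problem and the typed input coincide. [cite: BurungaleCastellaSkinner2025, Cor. 1.3.1 (p. 4)] -/
theorem missingPPartOverAt_iff_bsdp_of_classX4_of_goodOrd_twist
    (hGZK : rank_eq_analyticRank_of_analyticRank_le_one) (hmod : hasEntireLFunction_rat)
    (hMilne : Milne1972.bsdQuotient_baseChange_quadratic)
    (hBCS : BurungaleCastellaSkinner2025.cor131_padicValRat_bsd_rank_le_one)
    (hX : ClassX4 W p) (hcm : ¬ W.HasCM) (hp3 : 3 < p) (him : BigIm W p) (hr : W.analyticRank ≤ 1)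
    (h2 : Module.finrank ℚ K = 2) (hdK : (NumberField.discr K : ℚ) = (-1 : ℚ) ^ (p / 2) * p)
    (hWd : ∃ C : VariableChange ℚ, C • W.quadraticTwist (NumberField.discr K : ℚ) = Wd)
    (hord : GoodOrd Wd p) (hrd : Wd.analyticRank ≤ 1)
    (hW' : ∃ C : VariableChange K, C • W.baseChange K = W') :
    MissingPPartOverAt W' p ↔ BSDp W p := by
  have hWd' : ∃ C : VariableChange ℚ, C • W.quadraticTwist ((-1 : ℚ) ^ (p / 2) * p) = Wd := by
    rw [← hdK]; exact hWd
  exact missingPPartOverAt_iff_bsdp_of_bsdp_twist W p K Wd W' hGZK hmod hMilne hr h2 hWd hrd hW'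
    (RowC2.bsdp hBCS hGZK hrd (rowC2_twist_of_classX4 W p Wd hX hcm hp3 him hWd' hord))

end Summit.BirchSwinnertonDyer.Rank1Residual.Additive

end
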